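import Mathlib
import Summits.KontsevichZagierPeriods.KontsevichZagierPeriods.Theorems.SoloInformedLegendreSectorHalf
import HarnessLib
import HarnessLib.Audit

/-!
# Legendre's relation by moves, XVIII: the complete integral of the THIRD kind at a torsion parameter (solo-informed, s33)

THEOREM XXIV.  For every real algebraic modulus `0 < k < 1`, the complete elliptic integral of
the third kind with parameter `n = k`, `Π(k,k) = ∫₀¹ dx/((1 − kx²)√((1−x²)(1−k²x²)))`, satisfies
IN THE KONTSEVICH–ZAGIER PERIOD RING `P`
  `⟦[pt, 2(1−k)]⟧·⟦Π(k,k)⟧ = ⟦A⟧ + ⟦[pt, 1−k]⟧·⟦K(k)⟧`,  `2⟦A⟧ = ⟦π⟧`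
(`A = [(0,1), (1−x²)^{-1/2}]`), i.e. `Π(k,k) = K(k)/2 + π/(4(1−k))` in values.  The proof is ONE
MOVE: the rational substitution (rule 2) `y = (1−k)x/(1−kx²) : (0,1) → (0,1)` — Gauss's
transformation of file XII with `k ↦ −k` — has `1 − y² = (1−x²)(1−k²x²)/(1−kx²)²`,
`dy = (1−k)(1+kx²)dx/(1−kx²)²`, so it pulls `dy/√(1−y²)` back to `(1−k)(1+kx²)dx/((1−kx²)Δ)`,
and `(1−k)(1+kx²)/(1−kx²) = 2(1−k)/(1−kx²) − (1−k)` is additivity in the integrand (rule 1).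
The parameter `n = k` is a TORSION parameter: in Legendre's reduction of the circular case
`k² < n < 1` to incomplete integrals of modulus `k'` [Lawden 1989, (3.8.34)] the amplitude is the
bisection value `sin²φ = 1/(1+k) = sn²(K'/2, k')`, so those integrals are quarter-periods (Heuman
`Λ₀ = 1/2 + (1−k)K/π`).  THEOREM XXIV is thus the third-kind analogue of THEOREMS XIX/XX: the
relation the geometry of a torsion point forces on a third-kind period is produced by the rules.

COROLLARIES.  `⟦Π(k,k)⟧ ∈ K[⟦K⟧, ⟦π⟧]` for every algebraic modulus (so in the sector
`K[⟦K⟧,⟦K'⟧,⟦E⟧,⟦E'⟧]` by THEOREM XVII), and `⟦Π(1/√2, 1/√2)⟧ ∈ K[⟦K(1/√2)⟧, ⟦E(1/√2)⟧]`: a period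
of the THIRD kind inside a DECIDED sector (THEOREM XVIII).

References: A. M. Legendre, Traité des fonctions elliptiques I (1825) ch. XXIII; D. F. Lawden,
Elliptic Functions and Applications (1989) §§ 3.7–3.8; P. F. Byrd – M. D. Friedman, Handbook of
Elliptic Integrals (1971) 410–415; M. Kontsevich – D. Zagier, Periods (2001) § 1.2; this work.
-/

open MeasureTheory Set Filter
open scoped Classical

open Literature.NumberTheory.Transcendental Literature.NumberTheory.Transcendental.KZ
open Literature.ModelTheory.ExponentialFields

namespace Summit.KontsevichZagierPeriods.KontsevichZagierPeriods.Theorems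

/-! ### The substitution `y = (1−k)x/(1−kx²)` -/

/-- `0 < (1−k)x/(1−kx²) < 1` for `0 < x < 1`, `0 < k < 1`
(`1 − kx² − (1−k)x = (1−x)(1+kx) > 0`). [folklore] -/
theorem soloInformed_thirdKind_transformation_mem {k x : ℝ} (hk : k ∈ Ioo (0:ℝ) 1)
    (hx : x ∈ Ioo (0:ℝ) 1) : (1 - k) * x / (1 - k * x ^ 2) ∈ Ioo (0:ℝ) 1 := by
  have hden : 0 < 1 - k * x ^ 2 := by nlinarith [hk.1, hk.2, hx.1, hx.2]
  refine ⟨div_pos (by nlinarith [hk.2, hx.1]) hden, (div_lt_one hden).2 ?_⟩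
  nlinarith [mul_pos (sub_pos.2 hx.2) (show 0 < 1 + k * x by nlinarith [hk.1, hx.1])]

/-- **The third-kind move.** For real algebraic `0 < k < 1` the substitution
`y = (1−k)x/(1−kx²)` (rule 2) carries `R = [(0,1), (1−k)(1+kx²)(1−kx²)^{-1}((1−x²)(1−k²x²))^{-1/2}]`
onto the arcsine representation `A = [(0,1), (1−y²)^{-1/2}]`. [this work] -/
theorem soloInformed_thirdKind_move (k : ℝ) (hk : k ∈ Ioo (0:ℝ) 1) (hka : IsAlgebraic ℚ k)
    (R A : IntegralRep 1)
    (hRd : R.domain = {x : Fin 1 → ℝ | x 0 ∈ Ioo (0:ℝ) 1})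
    (hRi : ∀ x, R.integrand x = (1 - k) * (1 + k * x 0 ^ 2) / (1 - k * x 0 ^ 2) *
      ((√(1 - x 0 ^ 2))⁻¹ * (√(1 - k ^ 2 * x 0 ^ 2))⁻¹))
    (hAd : A.domain = {x : Fin 1 → ℝ | x 0 ∈ Ioo (0:ℝ) 1})
    (hAi : EqOn A.integrand (fun x => (√(1 - x 0 ^ 2))⁻¹) A.domain) :
    of R - of A ∈ changeOfVariablesRel := by
  have hsq := BallPeeling.isSemialgebraic_posIoo
  obtain ⟨hk0, hk1⟩ := hk
  have h1k : 0 < 1 - k := by linarith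
  have hden : ∀ x ∈ Icc (0:ℝ) 1, 0 < 1 - k * x ^ 2 := fun x hx => by
    nlinarith [hx.1, hx.2, mul_le_mul hx.2 hx.2 hx.1 zero_le_one]
  have hdenI : ∀ x ∈ Ioo (0:ℝ) 1, 0 < 1 - k * x ^ 2 := fun x hx => hden x ⟨hx.1.le, hx.2.le⟩
  have h1ka : IsAlgebraic ℚ (1 - k) := isAlgebraic_one.sub hka
  -- continuity of the transformation on `[0,1]`
  have hcont : ContinuousOn (fun x : ℝ => (1 - k) * x / (1 - k * x ^ 2)) (Icc (0:ℝ) 1) :=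
    ((continuous_const.mul continuous_id).continuousOn).div
      (continuous_const.sub (continuous_const.mul (continuous_pow 2))).continuousOn
      fun x hx => (hden x hx).ne'
  refine soloInformed_lift_mem_changeOfVariablesRel R A
    (g := fun x => (1 - k) * x / (1 - k * x ^ 2))
    (g' := fun x => (1 - k) * (1 + k * x ^ 2) / (1 - k * x ^ 2) ^ 2)
    (S := Ioo (0:ℝ) 1) (T := Ioo (0:ℝ) 1) hRd hAd ?_ (fun t ht => ?_) ?_ ?_ ?_
  · -- semialgebraicity
    rw [hRd]
    refine IsSemialgebraicMapOn.of_forall hsq fun j => ?_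
    have hq : IsSemialgebraicFunOn ℚ {x : Fin 1 → ℝ | x 0 ∈ Ioo (0:ℝ) 1}
        (fun x : Fin 1 → ℝ => 1 - k * x 0 ^ 2) :=
      ((isSemialgebraicFunOn_const_of_isAlgebraic hsq isAlgebraic_one).sub_holds
        ((isSemialgebraicFunOn_const_of_isAlgebraic hsq hka).mul_holds
          (isSemialgebraicFunOn_aeval hsq (MvPolynomial.X 0 ^ 2)))).congr fun x _ => by
        simp only [Pi.sub_apply, Pi.mul_apply, map_pow, MvPolynomial.aeval_X]
    refine ((((isSemialgebraicFunOn_const_of_isAlgebraic hsq h1ka).mul_holds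
      (isSemialgebraicFunOn_aeval hsq (MvPolynomial.X 0))).mul_holds
      (hq.inv fun x hx => (hdenI (x 0) hx).ne')).congr fun x _ => ?_)
    simp only [Pi.mul_apply, MvPolynomial.aeval_X, soloInformedLift, div_eq_mul_inv]
  · -- derivative (quotient rule)
    have h1 : HasDerivAt (fun x : ℝ => (1 - k) * x) ((1 - k) * 1) t :=
      (hasDerivAt_id' t).const_mul (1 - k)
    have h2 : HasDerivAt (fun x : ℝ => 1 - k * x ^ 2) (0 - k * (2 * t)) t :=
      (hasDerivAt_const t (1:ℝ)).sub ((soloInformed_hasDerivAt_sq t).const_mul k)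
    refine (h1.div h2 (hdenI t ht).ne').congr_deriv ?_
    field_simp
    ring
  · -- injectivity: `g a = g b ⇒ (a − b)(1 + kab) = 0`
    intro a ha b hb h
    have h' : (1 - k) * a / (1 - k * a ^ 2) = (1 - k) * b / (1 - k * b ^ 2) := h
    rw [div_eq_div_iff (hdenI a ha).ne' (hdenI b hb).ne'] at h'
    have e : (1 - k) * ((a - b) * (1 + k * a * b)) = 0 := by linear_combination h'
    have hab : 0 < 1 + k * a * b := by nlinarith [mul_pos ha.1 hb.1]
    rcases mul_eq_zero.1 e with e | e
    · linarith
    · rcases mul_eq_zero.1 e with e | e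
      · linarith
      · linarith
  · -- image `= (0,1)` (intermediate values on `[0,1]`)
    ext y
    constructor
    · rintro ⟨x, hx, rfl⟩
      exact soloInformed_thirdKind_transformation_mem ⟨hk0, hk1⟩ hx
    · intro hy
      have hg0 : (fun x : ℝ => (1 - k) * x / (1 - k * x ^ 2)) 0 = 0 := by simp
      have hg1 : (fun x : ℝ => (1 - k) * x / (1 - k * x ^ 2)) 1 = 1 := by
        simpa only [one_pow, mul_one] using div_self h1k.ne'
      have hyI : y ∈ Icc ((fun x : ℝ => (1 - k) * x / (1 - k * x ^ 2)) 0)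
          ((fun x : ℝ => (1 - k) * x / (1 - k * x ^ 2)) 1) := by
        rw [hg0, hg1]; exact ⟨hy.1.le, hy.2.le⟩
      obtain ⟨x, hx, hgx⟩ := intermediate_value_Icc zero_le_one hcont hyI
      refine ⟨x, ⟨lt_of_le_of_ne hx.1 ?_, lt_of_le_of_ne hx.2 ?_⟩, hgx⟩
      · rintro rfl; exact hy.1.ne (hg0 ▸ hgx)
      · rintro rfl; exact hy.2.ne' (hg1 ▸ hgx)
  · -- the integrand identity
    intro x hx
    have hs : x 0 ∈ Ioo (0:ℝ) 1 := by rw [hRd] at hx; exact hx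
    have hy := soloInformed_thirdKind_transformation_mem ⟨hk0, hk1⟩ hs
    have hmem : soloInformedLift (fun x : ℝ => (1 - k) * x / (1 - k * x ^ 2)) x ∈ A.domain :=
      hAd ▸ hy
    have hd := hdenI (x 0) hs
    have hw0 : 0 < 1 - x 0 ^ 2 := by nlinarith [hs.1, hs.2]
    have hv0 : 0 < 1 - k ^ 2 * x 0 ^ 2 :=
      (soloInformed_legendre_radicand_pos hs (by nlinarith : k ^ 2 < 1)).2
    have hu0 : 0 < 1 + k * x 0 ^ 2 := by nlinarith [hs.1, hs.2, hk1, hk0]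
    have hw : √(1 - x 0 ^ 2) ≠ 0 := (Real.sqrt_pos.2 hw0).ne'
    have hv : √(1 - k ^ 2 * x 0 ^ 2) ≠ 0 := (Real.sqrt_pos.2 hv0).ne'
    rw [hRi, hAi hmem]
    simp only [soloInformedLift]
    have e1 : 1 - ((1 - k) * x 0 / (1 - k * x 0 ^ 2)) ^ 2 =
        ((1 - x 0 ^ 2) * (1 - k ^ 2 * x 0 ^ 2)) / (1 - k * x 0 ^ 2) ^ 2 := by
      field_simp
      ring
    rw [e1, Real.sqrt_div' _ (sq_nonneg _), Real.sqrt_sq hd.le, Real.sqrt_mul hw0.le,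
      abs_of_pos (div_pos (mul_pos h1k hu0) (pow_pos hd 2))]
    field_simp

/-! ### The representation `Π(n, k)` -/

/-- **The third-kind integrand as a representation**: for algebraic `n, m ∈ (0,1)` there is
`Π = [(0,1), (1−nx²)^{-1}((1−x²)(1−mx²))^{-1/2}]` (bounded by `(1−n)^{-1}` times the first-kind
integrand). [this work] -/
theorem soloInformed_exists_ellipticPi_rep (n m : ℝ) (hn : n ∈ Ioo (0:ℝ) 1) (hna : IsAlgebraic ℚ n)
    (hm : m ∈ Ioo (0:ℝ) 1) (hma : IsAlgebraic ℚ m) :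
    ∃ P : IntegralRep 1, P.domain = {x : Fin 1 → ℝ | x 0 ∈ Ioo (0:ℝ) 1} ∧
      ∀ x, P.integrand x = (1 - n * x 0 ^ 2)⁻¹ * ((√(1 - x 0 ^ 2))⁻¹ * (√(1 - m * x 0 ^ 2))⁻¹) := by
  have hsq := BallPeeling.isSemialgebraic_posIoo
  have hmeas : MeasurableSet {x : Fin 1 → ℝ | x 0 ∈ Ioo (0:ℝ) 1} :=
    (measurable_pi_apply 0) measurableSet_Ioo
  have hnx : ∀ s ∈ Ioo (0:ℝ) 1, 0 < 1 - n * s ^ 2 := fun s hs =>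
    (soloInformed_legendre_radicand_pos hs hn.2).2
  obtain ⟨K₀, hK₀d, hK₀i⟩ := soloInformed_exists_ellipticK_rep m hm hma
  have hK₀int : IntegrableOn (fun x : Fin 1 → ℝ => (√(1 - x 0 ^ 2))⁻¹ * (√(1 - m * x 0 ^ 2))⁻¹)
      {x : Fin 1 → ℝ | x 0 ∈ Ioo (0:ℝ) 1} := by
    have h := K₀.integrableOn
    rwa [hK₀d, show K₀.integrand = fun x => (√(1 - x 0 ^ 2))⁻¹ * (√(1 - m * x 0 ^ 2))⁻¹ from
      funext hK₀i] at h
  have hsa : IsSemialgebraicFunOn ℚ {x : Fin 1 → ℝ | x 0 ∈ Ioo (0:ℝ) 1}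
      (fun x : Fin 1 → ℝ => (1 - n * x 0 ^ 2)⁻¹ * ((√(1 - x 0 ^ 2))⁻¹ * (√(1 - m * x 0 ^ 2))⁻¹)) :=
    (((soloInformed_sa_modulusFactors hn hna).1.inv fun x hx => (hnx (x 0) hx).ne').mul_holds
      (soloInformed_sa_arcsine.mul_holds (soloInformed_sa_modulusFactors hm hma).2)).congr
      fun x _ => by simp only [Pi.mul_apply]
  have hint : IntegrableOn (fun x : Fin 1 → ℝ => (1 - n * x 0 ^ 2)⁻¹ *
      ((√(1 - x 0 ^ 2))⁻¹ * (√(1 - m * x 0 ^ 2))⁻¹)) {x : Fin 1 → ℝ | x 0 ∈ Ioo (0:ℝ) 1} := by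
    refine Integrable.mono' (hK₀int.const_mul (1 - n)⁻¹)
      (by fun_prop : Measurable fun x : Fin 1 → ℝ => (1 - n * x 0 ^ 2)⁻¹ *
        ((√(1 - x 0 ^ 2))⁻¹ * (√(1 - m * x 0 ^ 2))⁻¹)).aestronglyMeasurable
      ((ae_restrict_iff' hmeas).2 (ae_of_all _ fun x hx => ?_))
    have hu := hnx (x 0) hx
    have hκ0 : 0 ≤ (√(1 - x 0 ^ 2))⁻¹ * (√(1 - m * x 0 ^ 2))⁻¹ := by positivity
    have hle : (1 - n * x 0 ^ 2)⁻¹ ≤ (1 - n)⁻¹ := by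
      have hx' : x 0 ∈ Ioo (0:ℝ) 1 := hx
      have hx2 : x 0 ^ 2 ≤ 1 := by nlinarith [hx'.1, hx'.2]
      exact inv_anti₀ (by linarith [hn.2]) (by nlinarith [mul_le_mul_of_nonneg_left hx2 hn.1.le])
    rw [Real.norm_eq_abs, abs_of_nonneg (by positivity)]
    exact mul_le_mul_of_nonneg_right hle hκ0
  exact ⟨⟨_, _, hsq, hsa, hint⟩, rfl, fun _ => rfl⟩

/-! ### THEOREM XXIV: `2(1−k)·Π(k,k) = A + (1−k)·K(k)` in `P` -/

/-- **THEOREM XXIV (the third-kind period at the torsion parameter `n = k`, in `P`).** For real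
algebraic `0 < k < 1` and representations `Π(k,k)`, `K(k)`, arcsine `A` on `(0,1)`:
  `⟦[pt, 2(1−k)]⟧·⟦Π⟧ = ⟦A⟧ + ⟦[pt, 1−k]⟧·⟦K⟧`
— ONE rule-(2) move `y = (1−k)x/(1−kx²)` and additivity in the integrand. [this work] -/
theorem soloInformed_ellipticPi_torsion (k : ℝ) (hk : k ∈ Ioo (0:ℝ) 1) (hka : IsAlgebraic ℚ k)
    (P K A : IntegralRep 1)
    (hPd : P.domain = {x : Fin 1 → ℝ | x 0 ∈ Ioo (0:ℝ) 1})
    (hPi : EqOn P.integrand (fun x => (1 - k * x 0 ^ 2)⁻¹ *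
      ((√(1 - x 0 ^ 2))⁻¹ * (√(1 - k ^ 2 * x 0 ^ 2))⁻¹)) P.domain)
    (hKd : K.domain = {x : Fin 1 → ℝ | x 0 ∈ Ioo (0:ℝ) 1})
    (hKi : EqOn K.integrand (fun x => (√(1 - x 0 ^ 2))⁻¹ * (√(1 - k ^ 2 * x 0 ^ 2))⁻¹) K.domain)
    (hAd : A.domain = {x : Fin 1 → ℝ | x 0 ∈ Ioo (0:ℝ) 1})
    (hAi : EqOn A.integrand (fun x => (√(1 - x 0 ^ 2))⁻¹) A.domain)
    (h2k : IsAlgebraic ℚ (2 * (1 - k))) (h1k : IsAlgebraic ℚ (1 - k)) :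
    toFormalPeriod (of (IntegralRep.unit.constMul (2 * (1 - k)) h2k)) * toFormalPeriod (of P) =
      toFormalPeriod (of A) +
        toFormalPeriod (of (IntegralRep.unit.constMul (1 - k) h1k)) * toFormalPeriod (of K) := by
  have hsq := BallPeeling.isSemialgebraic_posIoo
  have hmeas : MeasurableSet {x : Fin 1 → ℝ | x 0 ∈ Ioo (0:ℝ) 1} :=
    (measurable_pi_apply 0) measurableSet_Ioo
  obtain ⟨hk0, hk1⟩ := hk
  have hk2a : IsAlgebraic ℚ (k ^ 2) := hka.pow 2
  have hμ : k ^ 2 ∈ Ioo (0:ℝ) 1 := ⟨by positivity, by nlinarith⟩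
  have hfacts : ∀ s ∈ Ioo (0:ℝ) 1, 0 < 1 - s ^ 2 ∧ 0 < 1 - k ^ 2 * s ^ 2 ∧ 0 < 1 - k * s ^ 2 :=
    fun s hs => ⟨(soloInformed_legendre_radicand_pos hs (by nlinarith : k ^ 2 < 1)).1,
      (soloInformed_legendre_radicand_pos hs (by nlinarith : k ^ 2 < 1)).2,
      (soloInformed_legendre_radicand_pos hs hk1).2⟩
  -- the first-kind integrand is integrable
  obtain ⟨K₀, hK₀d, hK₀i⟩ := soloInformed_exists_ellipticK_rep (k ^ 2) hμ hk2a
  have hK₀int : IntegrableOn (fun x : Fin 1 → ℝ => (√(1 - x 0 ^ 2))⁻¹ * (√(1 - k ^ 2 * x 0 ^ 2))⁻¹)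
      {x : Fin 1 → ℝ | x 0 ∈ Ioo (0:ℝ) 1} := by
    have h := K₀.integrableOn
    rwa [hK₀d, show K₀.integrand = fun x => (√(1 - x 0 ^ 2))⁻¹ * (√(1 - k ^ 2 * x 0 ^ 2))⁻¹ from
      funext hK₀i] at h
  -- the source `R` of the move
  obtain ⟨R, hRd, hRi⟩ : ∃ R : IntegralRep 1, R.domain = {x : Fin 1 → ℝ | x 0 ∈ Ioo (0:ℝ) 1} ∧
      ∀ x, R.integrand x = (1 - k) * (1 + k * x 0 ^ 2) / (1 - k * x 0 ^ 2) *
        ((√(1 - x 0 ^ 2))⁻¹ * (√(1 - k ^ 2 * x 0 ^ 2))⁻¹) := by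
    have hp : IsSemialgebraicFunOn ℚ {x : Fin 1 → ℝ | x 0 ∈ Ioo (0:ℝ) 1}
        (fun x : Fin 1 → ℝ => 1 + k * x 0 ^ 2) :=
      ((isSemialgebraicFunOn_const_of_isAlgebraic hsq isAlgebraic_one).add_holds
        ((isSemialgebraicFunOn_const_of_isAlgebraic hsq hka).mul_holds
          (isSemialgebraicFunOn_aeval hsq (MvPolynomial.X 0 ^ 2)))).congr fun x _ => by
        simp only [Pi.add_apply, Pi.mul_apply, map_pow, MvPolynomial.aeval_X]
    have hsa : IsSemialgebraicFunOn ℚ {x : Fin 1 → ℝ | x 0 ∈ Ioo (0:ℝ) 1}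
        (fun x : Fin 1 → ℝ => (1 - k) * (1 + k * x 0 ^ 2) / (1 - k * x 0 ^ 2) *
          ((√(1 - x 0 ^ 2))⁻¹ * (√(1 - k ^ 2 * x 0 ^ 2))⁻¹)) := by
      refine (((((isSemialgebraicFunOn_const_of_isAlgebraic hsq h1k).mul_holds hp).mul_holds
        ((soloInformed_sa_modulusFactors ⟨hk0, hk1⟩ hka).1.inv fun x hx =>
          (hfacts (x 0) hx).2.2.ne')).mul_holds
        (soloInformed_sa_arcsine.mul_holds (soloInformed_sa_modulusFactors hμ hk2a).2)).congr
        fun x _ => ?_)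
      simp only [Pi.mul_apply, div_eq_mul_inv]
    have hint : IntegrableOn (fun x : Fin 1 → ℝ => (1 - k) * (1 + k * x 0 ^ 2) / (1 - k * x 0 ^ 2) *
        ((√(1 - x 0 ^ 2))⁻¹ * (√(1 - k ^ 2 * x 0 ^ 2))⁻¹)) {x : Fin 1 → ℝ | x 0 ∈ Ioo (0:ℝ) 1} := by
      refine Integrable.mono' (hK₀int.const_mul (1 + k))
        (by fun_prop : Measurable fun x : Fin 1 → ℝ => (1 - k) * (1 + k * x 0 ^ 2) /
          (1 - k * x 0 ^ 2) * ((√(1 - x 0 ^ 2))⁻¹ * (√(1 - k ^ 2 * x 0 ^ 2))⁻¹)).aestronglyMeasurable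
        ((ae_restrict_iff' hmeas).2 (ae_of_all _ fun x hx => ?_))
      obtain ⟨hw0, hv0, hu0⟩ := hfacts (x 0) hx
      have hx' : x 0 ∈ Ioo (0:ℝ) 1 := hx
      have hκ0 : 0 ≤ (√(1 - x 0 ^ 2))⁻¹ * (√(1 - k ^ 2 * x 0 ^ 2))⁻¹ := by positivity
      have hratio : (1 - k) * (1 + k * x 0 ^ 2) / (1 - k * x 0 ^ 2) ≤ 1 + k := by
        rw [div_le_iff₀ hu0]
        have hx2 : x 0 ^ 2 ≤ 1 := by nlinarith [hx'.1, hx'.2]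
        nlinarith [mul_le_mul_of_nonneg_left hx2 hk0.le]
      have hpos : 0 ≤ (1 - k) * (1 + k * x 0 ^ 2) / (1 - k * x 0 ^ 2) :=
        div_nonneg (mul_nonneg (by linarith) (by positivity)) hu0.le
      rw [Real.norm_eq_abs, abs_of_nonneg (mul_nonneg hpos hκ0)]
      exact mul_le_mul_of_nonneg_right hratio hκ0
    exact ⟨⟨_, _, hsq, hsa, hint⟩, rfl, fun _ => rfl⟩
  -- (m1) the move `y = (1−k)x/(1−kx²)`
  have hm1 : of R - of A ∈ relations := changeOfVariablesRel_subset_relations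
    (soloInformed_thirdKind_move k ⟨hk0, hk1⟩ hka R A hRd hRi hAd hAi)
  -- (m2) `2(1−k)·Π = R + (1−k)·K` (rule 1b)
  have hm2 : of (P.constMul (2 * (1 - k)) h2k) - of R - of (K.constMul (1 - k) h1k) ∈ relations := by
    refine integrandAddRel_subset_relations ⟨1, P.constMul (2 * (1 - k)) h2k, R,
      K.constMul (1 - k) h1k, by rw [hRd, IntegralRep.domain_constMul, hPd],
      by rw [IntegralRep.domain_constMul, IntegralRep.domain_constMul, hKd, hPd], fun x hx => ?_, rfl⟩
    rw [IntegralRep.domain_constMul] at hx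
    have hxK : x ∈ K.domain := by rw [hKd]; rw [hPd] at hx; exact hx
    have hs : x 0 ∈ Ioo (0:ℝ) 1 := by rw [hPd] at hx; exact hx
    obtain ⟨hw0, hv0, hu0⟩ := hfacts (x 0) hs
    have hw : √(1 - x 0 ^ 2) ≠ 0 := (Real.sqrt_pos.2 hw0).ne'
    have hv : √(1 - k ^ 2 * x 0 ^ 2) ≠ 0 := (Real.sqrt_pos.2 hv0).ne'
    simp only [Pi.add_apply, IntegralRep.integrand_constMul, hPi hx, hKi hxK, hRi]
    field_simp
    ring
  -- assembly in `P`
  have e1 : toFormalPeriod (of R) = toFormalPeriod (of A) := toFormalPeriod_eq_iff.2 hm1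
  have e2 : toFormalPeriod (of (P.constMul (2 * (1 - k)) h2k)) = toFormalPeriod (of R) +
      toFormalPeriod (of (K.constMul (1 - k) h1k)) := by
    have h := toFormalPeriod_eq_iff.2 (show of (P.constMul (2 * (1 - k)) h2k) -
        (of R + of (K.constMul (1 - k) h1k)) ∈ relations by
      have e : of (P.constMul (2 * (1 - k)) h2k) - (of R + of (K.constMul (1 - k) h1k)) =
        of (P.constMul (2 * (1 - k)) h2k) - of R - of (K.constMul (1 - k) h1k) := by abel
      rw [e]; exact hm2)
    rw [h, map_add]
  rw [toFormalPeriod_of_constMul (2 * (1 - k)) h2k P, toFormalPeriod_of_constMul (1 - k) h1k K,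
    e1] at e2
  exact e2

/-- **THEOREM XXIV with `π`**: `2·⟦[pt,2(1−k)]⟧⟦Π(k,k)⟧ = ⟦π⟧ + 2·⟦[pt,1−k]⟧⟦K(k)⟧` in `P`
(`2⟦A⟧ = ⟦π⟧`, file VI). [this work] -/
theorem soloInformed_ellipticPi_torsion_pi (k : ℝ) (hk : k ∈ Ioo (0:ℝ) 1) (hka : IsAlgebraic ℚ k)
    (P K : IntegralRep 1)
    (hPd : P.domain = {x : Fin 1 → ℝ | x 0 ∈ Ioo (0:ℝ) 1})
    (hPi : EqOn P.integrand (fun x => (1 - k * x 0 ^ 2)⁻¹ *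
      ((√(1 - x 0 ^ 2))⁻¹ * (√(1 - k ^ 2 * x 0 ^ 2))⁻¹)) P.domain)
    (hKd : K.domain = {x : Fin 1 → ℝ | x 0 ∈ Ioo (0:ℝ) 1})
    (hKi : EqOn K.integrand (fun x => (√(1 - x 0 ^ 2))⁻¹ * (√(1 - k ^ 2 * x 0 ^ 2))⁻¹) K.domain)
    (h2k : IsAlgebraic ℚ (2 * (1 - k))) (h1k : IsAlgebraic ℚ (1 - k)) :
    2 * (toFormalPeriod (of (IntegralRep.unit.constMul (2 * (1 - k)) h2k)) * toFormalPeriod (of P)) =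
      toFormalPeriod (of KZ.piRep) +
        2 * (toFormalPeriod (of (IntegralRep.unit.constMul (1 - k) h1k)) * toFormalPeriod (of K)) := by
  obtain ⟨A, hAd, hAi⟩ := soloInformed_exists_arcsine_rep
  rw [soloInformed_ellipticPi_torsion k hk hka P K A hPd hPi hKd hKi hAd (fun x _ => hAi x) h2k h1k,
    mul_add, soloInformed_two_mul_toFormalPeriod_arcsine A hAd (fun x _ => hAi x)]

/-- **THEOREM XXIV in values**: `Π(k,k) = K(k)/2 + π/(4(1−k))`.
[classical, cf. Lawden 1989 (3.8.34); this work] -/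
theorem soloInformed_ellipticPi_torsion_value (k : ℝ) (hk : k ∈ Ioo (0:ℝ) 1) (hka : IsAlgebraic ℚ k)
    (P K : IntegralRep 1)
    (hPd : P.domain = {x : Fin 1 → ℝ | x 0 ∈ Ioo (0:ℝ) 1})
    (hPi : EqOn P.integrand (fun x => (1 - k * x 0 ^ 2)⁻¹ *
      ((√(1 - x 0 ^ 2))⁻¹ * (√(1 - k ^ 2 * x 0 ^ 2))⁻¹)) P.domain)
    (hKd : K.domain = {x : Fin 1 → ℝ | x 0 ∈ Ioo (0:ℝ) 1})
    (hKi : EqOn K.integrand (fun x => (√(1 - x 0 ^ 2))⁻¹ * (√(1 - k ^ 2 * x 0 ^ 2))⁻¹) K.domain) :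
    P.value = K.value / 2 + Real.pi / (4 * (1 - k)) := by
  have h1k0 : (1 - k : ℝ) ≠ 0 := by linarith [hk.2]
  have h1k : IsAlgebraic ℚ (1 - k) := isAlgebraic_one.sub hka
  have h2k : IsAlgebraic ℚ (2 * (1 - k)) := (isAlgebraic_nat (R := ℚ) (A := ℝ) 2).mul h1k
  have h := congrArg evalP (soloInformed_ellipticPi_torsion_pi k hk hka P K hPd hPi hKd hKi h2k h1k)
  simp only [map_mul, map_add, map_ofNat, evalP_toFormalPeriod_of, IntegralRep.value_constMul,
    IntegralRep.value_unit, mul_one, piRep_value] at h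
  have h' : 4 * (1 - k) * P.value = Real.pi + 2 * (1 - k) * K.value := by linear_combination h
  rw [show P.value = (4 * (1 - k) * P.value) / (4 * (1 - k)) by field_simp, h']
  field_simp
  ring

/-! ### COROLLARIES: the third-kind class lies in the elliptic hulls -/

/-- **COROLLARY XXIV.1.** `⟦Π(k,k)⟧` lies in every `K`-hull containing `⟦K(k)⟧` and `⟦π⟧`.
[this work] -/
theorem soloInformed_ellipticPi_mem_algHull (k : ℝ) (hk : k ∈ Ioo (0:ℝ) 1) (hka : IsAlgebraic ℚ k)
    (P K : IntegralRep 1)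
    (hPd : P.domain = {x : Fin 1 → ℝ | x 0 ∈ Ioo (0:ℝ) 1})
    (hPi : EqOn P.integrand (fun x => (1 - k * x 0 ^ 2)⁻¹ *
      ((√(1 - x 0 ^ 2))⁻¹ * (√(1 - k ^ 2 * x 0 ^ 2))⁻¹)) P.domain)
    (hKd : K.domain = {x : Fin 1 → ℝ | x 0 ∈ Ioo (0:ℝ) 1})
    (hKi : EqOn K.integrand (fun x => (√(1 - x 0 ^ 2))⁻¹ * (√(1 - k ^ 2 * x 0 ^ 2))⁻¹) K.domain)
    {l : ℕ} (c : Fin l → FormalPeriodRing) (hKc : toFormalPeriod (of K) ∈ soloInformedAlgHull c)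
    (hπc : toFormalPeriod (of KZ.piRep) ∈ soloInformedAlgHull c) :
    toFormalPeriod (of P) ∈ soloInformedAlgHull c := by
  have h4k0 : (4 * (1 - k) : ℝ) ≠ 0 := (by linarith [hk.2] : (0:ℝ) < 4 * (1 - k)).ne'
  have h1k : IsAlgebraic ℚ (1 - k) := isAlgebraic_one.sub hka
  have h2k : IsAlgebraic ℚ (2 * (1 - k)) := (isAlgebraic_nat (R := ℚ) (A := ℝ) 2).mul h1k
  have h4k : IsAlgebraic ℚ (4 * (1 - k)) := (isAlgebraic_nat (R := ℚ) (A := ℝ) 4).mul h1k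
  have h4ki : IsAlgebraic ℚ (4 * (1 - k))⁻¹ := h4k.inv
  have h := soloInformed_ellipticPi_torsion_pi k hk hka P K hPd hPi hKd hKi h2k h1k
  -- `2·⟦[pt, 2(1−k)]⟧ = ⟦[pt, 4(1−k)]⟧`
  have h22 : (2 : FormalPeriodRing) * toFormalPeriod (of (IntegralRep.unit.constMul (2 * (1 - k)) h2k)) =
      toFormalPeriod (of (IntegralRep.unit.constMul (4 * (1 - k)) h4k)) := by
    have e : toFormalPeriod (of (IntegralRep.unit.constMul (2 * (1 - k) + 2 * (1 - k)) (h2k.add h2k))) =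
        toFormalPeriod (of (IntegralRep.unit.constMul (4 * (1 - k)) h4k)) := by
      congr 2; ring
    rw [two_mul, soloInformed_pointRep_add (2 * (1 - k)) (2 * (1 - k)) h2k h2k (h2k.add h2k), e]
  have hP : toFormalPeriod (of P) = toFormalPeriod (of (IntegralRep.unit.constMul (4 * (1 - k))⁻¹ h4ki)) *
      (toFormalPeriod (of KZ.piRep) +
        2 * (toFormalPeriod (of (IntegralRep.unit.constMul (1 - k) h1k)) * toFormalPeriod (of K))) := by
    rw [← h, ← mul_assoc 2, h22, ← mul_assoc, soloInformed_pointRep_inv_mul (4 * (1 - k)) h4k h4k0 h4ki,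
      one_mul]
  rw [hP]
  exact mul_mem (soloInformed_pointRep_mem_algHull c _ h4ki) (add_mem hπc (mul_mem (ofNat_mem _ 2)
    (mul_mem (soloInformed_pointRep_mem_algHull c _ h1k) hKc)))

/-- **COROLLARY XXIV.2 (a third-kind period in a decided sector).** At the lemniscatic modulus
`k = 1/√2 = √2/2`: `⟦Π(√2/2, √2/2)⟧ ∈ K[⟦K(1/√2)⟧, ⟦E(1/√2)⟧]`, the hull on which the period
conjecture holds unconditionally (THEOREM XVIII); in particular any representation with the class
of `Π(√2/2,√2/2)·(algebraic)` and any class of the hull with the same value are equivalent under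
the three rules. [this work] -/
theorem soloInformed_ellipticPi_mem_hull_ellipticHalf (K E P : IntegralRep 1)
    (hKd : K.domain = {x : Fin 1 → ℝ | x 0 ∈ Ioo (0:ℝ) 1})
    (hKi : EqOn K.integrand
      (fun x => (√(1 - x 0 ^ 2))⁻¹ * (√(1 - (1 / 2 : ℝ) * x 0 ^ 2))⁻¹) K.domain)
    (hEd : E.domain = {x : Fin 1 → ℝ | x 0 ∈ Ioo (0:ℝ) 1})
    (hEi : EqOn E.integrand (fun x => (1 - (1 / 2 : ℝ) * x 0 ^ 2) *
      ((√(1 - x 0 ^ 2))⁻¹ * (√(1 - (1 / 2 : ℝ) * x 0 ^ 2))⁻¹)) E.domain)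
    (hPd : P.domain = {x : Fin 1 → ℝ | x 0 ∈ Ioo (0:ℝ) 1})
    (hPi : EqOn P.integrand (fun x => (1 - √2 / 2 * x 0 ^ 2)⁻¹ *
      ((√(1 - x 0 ^ 2))⁻¹ * (√(1 - (1 / 2 : ℝ) * x 0 ^ 2))⁻¹)) P.domain) :
    toFormalPeriod (of P) ∈ soloInformedAlgHull ![toFormalPeriod (of K), toFormalPeriod (of E)] := by
  have hs2 : (√2 : ℝ) ^ 2 = 2 := Real.sq_sqrt (by norm_num)
  have hlo : (4 / 3 : ℝ) < √2 := by nlinarith [Real.sqrt_nonneg 2]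
  have hhi : (√2 : ℝ) < 3 / 2 := by nlinarith [Real.sqrt_nonneg 2]
  have hk : (√2 / 2 : ℝ) ∈ Ioo (0:ℝ) 1 := ⟨by linarith, by linarith⟩
  have h2a : IsAlgebraic ℚ (√2 : ℝ) := ⟨Polynomial.X ^ 2 - Polynomial.C 2,
    (Polynomial.monic_X_pow_sub_C (2 : ℚ) two_ne_zero).ne_zero, by simp [Real.sq_sqrt]⟩
  have hka : IsAlgebraic ℚ (√2 / 2 : ℝ) := h2a.mul (isAlgebraic_nat (R := ℚ) (A := ℝ) 2).inv
  have hq : (√2 / 2 : ℝ) ^ 2 = 1 / 2 := by nlinarith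
  have hK := soloInformed_mem_algHull_self ![toFormalPeriod (of K), toFormalPeriod (of E)] 0
  simp only [Matrix.cons_val_zero] at hK
  refine soloInformed_ellipticPi_mem_algHull (√2 / 2) hk hka P K hPd (by rw [hq]; exact hPi) hKd
    (by rw [hq]; exact hKi) _ hK
    (soloInformed_piRep_mem_hull_ellipticHalf K E hKd hKi hEd hEi)

end Summit.KontsevichZagierPeriods.KontsevichZagierPeriods.Theorems
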